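import Literature.Probability.FitznerVanDerHofstad2017.BlockComposition
import Literature.Probability.FitznerVanDerHofstad2017.BlockSummationRight

/-!
# [FvdH17] §5.1 (5.5) read from the second pair: composite blocks in the right chain — sub-multiplicativity for `matBR`, PROVED in abstract form

Source: R. Fitzner, R. van der Hofstad, *Mean-field behavior for nearest-neighbor percolation in `d > 10`*,
Electron. J. Probab. **22** (2017) no. 43 [FvdH17]; page and equation numbers are those of the extended version
arXiv:1506.07977v2.  §5.1 (5.5) (p. 48): "`B̄^{ι,a,b}(0,v,x,y) = Σ_{u,w} Σ_{c=0}^{2} A^{ι,a,c}(0,v,w,u)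
A^{c,b,*}(w,u,x,y) + A^{ι,a,b}(0,v,x,y) + B̄^{(2),ι,a,b}(0,v,x,y)`"; §6.2.1 (6.50) (p. 65): "`R^{(N),a}(x,y) =
Σ_{u,v} Σ_κ Σ_{b=0}^{2} B̄^{κ,a,b}(x,y,u,v) R^{(N−1),b}(u,v)`"; notebook [FvdHnb] `Percolation.nb`:
`Matrix[Bbar,s]=Matrix[Aiota,s].Matrix[ANonRep,s]+Matrix[Aiota,s]+Matrix[Bbar2i,s]`.

What this module proves — everything is kernel-checked; NOTHING here is a cited hypothesis.  `BlockSummationRight`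
showed that the column step for (6.50) consumes `matBR B̄`, the matrix of `B̄` read from its SECOND pair
(`sup_v Σ_{κ,x,y} B̄^{κ,a,b}(x,y,0,v)`); `BlockComposition` gave the sub-multiplicativity of the first-pair matrices
`matB`.  Here the two are joined: for composite blocks of the (5.5) shape the second-pair matrices are
sub-multiplicative IN THE SAME INDEX ORDER,
* `swapPairs_comp` — reading a composite from its second pair reverses the factors:
  `swapPairs (M₁ ∘ M₂) = swapPairs M₂ ∘ swapPairs M₁`;
* `tsum₂_comp_swap`, `normB_swapPairs_comp_le` — `(M₁∘M₂)^{2nd} ≤ (M₂)^{2nd} (M₁)^{2nd}` when `M₁` is translation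
  invariant;
* `matBR₀` (direction-free family read from the second pair), `matBR_comp_le` —
  `matBR (κ,a,b ↦ Σ_c A₁^{κ,a,c} ∘ A₂^{c,b}) ≤ matBR A₁ * matBR₀ A₂` entrywise (direction index on the first factor,
  translation invariance needed for `A₁`), `matBR_add_le`;
so that, whichever of the two readings of `(B̄)_{a,b}` a later instantiation needs (first pair: `BlockComposition`;
second pair: this module — see the reading note in `BlockSummationRight` and the package's DIVERGENCE.md D63 (d)),
the matrix of the composite (5.5) is bounded by the corresponding product-plus-sum of the matrices of its
constituents.  Abstract setting as before: sites any additive commutative group `G`, kernels in `[0, ∞]`, finite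
class type `ι`, finite direction type `K`; no block of §5.1 is defined here and no number is produced.
-/

noncomputable section

namespace Literature.Probability.FitznerVanDerHofstad2017.BlockSummation

open scoped ENNReal Matrix

section CompRight

variable {G ι K : Type*}

/-- Reading a composite block from its second pair reverses the order of the factors. [folklore] -/
theorem swapPairs_comp (M₁ M₂ : G → G → G → G → ℝ≥0∞) :
    swapPairs (comp M₁ M₂) = comp (swapPairs M₂) (swapPairs M₁) := by
  funext u v x y
  simp only [swapPairs_apply, comp]
  exact tsum_congr fun w => tsum_congr fun t => mul_comm _ _

/-- Tonelli for a composite summed over its FIRST pair: `Σ_{x,y} (M₁∘M₂)(x,y,u,v) = Σ_{w,t} M₂(w,t,u,v) Σ_{x,y}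
M₁(x,y,w,t)`. [folklore] -/
theorem tsum₂_comp_swap (M₁ M₂ : G → G → G → G → ℝ≥0∞) (u v : G) :
    ∑' x, ∑' y, comp M₁ M₂ x y u v = ∑' w, ∑' t, M₂ w t u v * ∑' x, ∑' y, M₁ x y w t := by
  have h := tsum₂_comp (swapPairs M₂) (swapPairs M₁) u v
  rw [← swapPairs_comp] at h
  simpa only [swapPairs_apply] using h

variable [AddCommGroup G]

/-- **Sub-multiplicativity read from the second pair:** `(M₁∘M₂)^{2nd} ≤ (M₂)^{2nd} · (M₁)^{2nd}` for translation-
invariant `M₁`, where `M^{2nd} = normB (swapPairs M) = sup_v Σ_{x,y} M(x,y,0,v)`.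
[cite: FitznerVanDerHofstad2017, §5.1 (5.5) and §6.2.1 (6.50) (arXiv:1506.07977v2 pp. 48, 65)] -/
theorem normB_swapPairs_comp_le {M₁ : G → G → G → G → ℝ≥0∞} (h₁ : IsTransInv M₁)
    (M₂ : G → G → G → G → ℝ≥0∞) :
    normB (swapPairs (comp M₁ M₂)) ≤ normB (swapPairs M₂) * normB (swapPairs M₁) := by
  rw [swapPairs_comp]
  exact normB_comp_le _ h₁.swapPairs

/-- The second-pair matrix of a direction-free family, `sup_v Σ_{x,y} A^{a,b}(x,y,0,v)`. [folklore] -/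
def matBR₀ (A : ι → ι → G → G → G → G → ℝ≥0∞) : Matrix ι ι ℝ≥0∞ :=
  matB₀ (fun a b => swapPairs (A a b))

/-- Entries of `matBR₀`. [folklore] -/
theorem matBR₀_apply (A : ι → ι → G → G → G → G → ℝ≥0∞) (a b : ι) :
    matBR₀ A a b = normB (swapPairs (A a b)) := rfl

/-- **(5.5), first term, read from the second pair, at matrix level:** for a translation-invariant family
`A₁^{κ,a,c}` carrying the direction index and a direction-free family `A₂^{c,b}`,
`matBR (κ,a,b ↦ Σ_c A₁^{κ,a,c} ∘ A₂^{c,b}) ≤ matBR A₁ * matBR₀ A₂` entrywise — the same index order as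
`BlockComposition.matB_comp_le`, with the roles of the uniform bound exchanged (here it is the FIRST factor whose
exit sum is bounded uniformly in its entry pair).
[cite: FitznerVanDerHofstad2017, §5.1 (5.5) and §6.2.1 (6.50) (arXiv:1506.07977v2 pp. 48, 65)] -/
theorem matBR_comp_le [Fintype ι] [Fintype K] {A₁ : K → ι → ι → G → G → G → G → ℝ≥0∞}
    (h₁ : ∀ κ a c, IsTransInv (A₁ κ a c)) (A₂ : ι → ι → G → G → G → G → ℝ≥0∞) (a b : ι) :
    matBR (fun κ a b => fun u v x y => ∑ c, comp (A₁ κ a c) (A₂ c b) u v x y) a b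
      ≤ (matBR A₁ * matBR₀ A₂) a b := by
  have key : ∀ c w t, ∑ κ, ∑' x, ∑' y, A₁ κ a c x y w t ≤ matBR A₁ a c := by
    intro c w t
    simp only [← tsum_finsetSum]
    exact tsum₂_le_normB (M := fun u v x y => ∑ κ, swapPairs (A₁ κ a c) u v x y)
      (IsTransInv.finsetSum Finset.univ fun κ _ => (h₁ κ a c).swapPairs) w t
  rw [Matrix.mul_apply, matBR_apply]
  refine iSup_le fun v => ?_
  calc ∑' x, ∑' y, ∑ κ, ∑ c, comp (A₁ κ a c) (A₂ c b) x y 0 v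
      = ∑ κ, ∑ c, ∑' w, ∑' t, A₂ c b w t 0 v * ∑' x, ∑' y, A₁ κ a c x y w t := by
        simp only [tsum_finsetSum, tsum₂_comp_swap]
    _ = ∑ c, ∑' w, ∑' t, A₂ c b w t 0 v * ∑ κ, ∑' x, ∑' y, A₁ κ a c x y w t := by
        rw [Finset.sum_comm]
        refine Finset.sum_congr rfl fun c _ => ?_
        simp only [Finset.mul_sum, tsum_finsetSum]
    _ ≤ ∑ c, ∑' w, ∑' t, A₂ c b w t 0 v * matBR A₁ a c :=
        Finset.sum_le_sum fun c _ => ENNReal.tsum_le_tsum fun w => ENNReal.tsum_le_tsum fun t =>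
          mul_le_mul' le_rfl (key c w t)
    _ = ∑ c, (∑' w, ∑' t, A₂ c b w t 0 v) * matBR A₁ a c := by simp only [ENNReal.tsum_mul_right]
    _ ≤ ∑ c, matBR₀ A₂ c b * matBR A₁ a c :=
        Finset.sum_le_sum fun c _ => mul_le_mul' (by
          rw [matBR₀_apply]
          exact tsum₂_zero_le_normB (swapPairs (A₂ c b)) v) le_rfl
    _ = ∑ c, matBR A₁ a c * matBR₀ A₂ c b := Finset.sum_congr rfl fun c _ => mul_comm _ _

/-- Sub-additivity of `matBR` (the `+` of (5.5) read from the second pair). [folklore] -/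
theorem matBR_add_le [Fintype K] (B₁ B₂ : K → ι → ι → G → G → G → G → ℝ≥0∞) (a b : ι) :
    matBR (fun κ a b => fun u v x y => B₁ κ a b u v x y + B₂ κ a b u v x y) a b ≤ (matBR B₁ + matBR B₂) a b :=
  matB_add_le (fun κ a b => swapPairs (B₁ κ a b)) (fun κ a b => swapPairs (B₂ κ a b)) a b

/-- A direction-free family read from the second pair is a family over the one-point direction type. [folklore] -/
theorem matBR₀_eq_matBR (A : ι → ι → G → G → G → G → ℝ≥0∞) :
    matBR₀ A = matBR (fun (_ : Unit) a b => A a b) :=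
  matB₀_eq_matB _

end CompRight

end Literature.Probability.FitznerVanDerHofstad2017.BlockSummation

end
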